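import Literature.NumberTheory.LFunctions.ExplicitFormulaPsiOne
import Mathlib.Analysis.SpecialFunctions.Integrals.Basic
import HarnessLib

/-!
# RiemannHypothesis / Nyman–Beurling — the DILATE ZERO SUMS, IV: the prime part
# `ψ₁(x)/x + 2x ∫_1^x ψ₁(t) t⁻³ dt = Σ_{n ≤ x} Λ(n)(x/n − 1)` (RH-FREE, elementary)

Step IV of the T7 programme (`NymanBeurlingDilateZeroSumIntegral.lean` ff.).  On `[1, x]` the Riesz mean
`ψ₁(t) = Σ_{n ≤ t} Λ(n)(t − n)` is the finite sum `Σ_{n ≤ x} Λ(n)(t − n)⁺` of continuous functions (`psiOne_eq_sum_posPart`),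
`∫_1^x (t − n)⁺ t⁻³ dt = 1/(2n) − 1/x + n/(2x²)` for `1 ≤ n ≤ x` (`integral_posPart_div_cube`), whence the displayed identity
(`psiBracket_eq`); also the three elementary integrals `∫_1^x dt/(2t)`, `∫_1^x t⁻² dt`, `∫_1^x t⁻³ dt` used in the assembly.
RH-FREE [rh-li-eng-3 g5]: finite sums and one-variable calculus; nothing here bears on the truth of RH.
-/

noncomputable section

set_option linter.dupNamespace false

open Filter Set MeasureTheory Topology intervalIntegral
open scoped Real

namespace Summit.RiemannHypothesis.RiemannHypothesis.Theorems.NbTheory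

open Literature.NumberTheory.LFunctions

namespace DilateExplicit

/-! ## `ψ₁` on `[1, x]` as a finite sum of hinge functions -/

/-- For `0 ≤ t ≤ x`: `ψ₁(t) = Σ_{n ∈ (0, ⌊x⌋]} Λ(n) · (t − n)⁺`. -/
theorem psiOne_eq_sum_posPart {x t : ℝ} (ht0 : 0 ≤ t) (htx : t ≤ x) :
    psiOne t = ∑ n ∈ Finset.Ioc 0 ⌊x⌋₊, (ArithmeticFunction.vonMangoldt n : ℝ) * max (t - n) 0 := by
  rw [psiOne]
  have hsub : Finset.Ioc 0 ⌊t⌋₊ ⊆ Finset.Ioc 0 ⌊x⌋₊ := by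
    intro n hn
    rw [Finset.mem_Ioc] at hn ⊢
    exact ⟨hn.1, hn.2.trans (Nat.floor_le_floor htx)⟩
  rw [← Finset.sum_subset hsub]
  · refine Finset.sum_congr rfl fun n hn ↦ ?_
    rw [Finset.mem_Ioc] at hn
    have hnt : (n : ℝ) ≤ t := (Nat.cast_le.2 hn.2).trans (Nat.floor_le ht0)
    rw [max_eq_left (by linarith)]
  · intro n hn hn'
    rw [Finset.mem_Ioc] at hn hn'
    have hlt : ⌊t⌋₊ < n := by
      by_contra h
      exact hn' ⟨hn.1, not_lt.1 h⟩
    have htn : t < n := by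
      have := Nat.lt_of_floor_lt hlt
      exact_mod_cast this
    rw [max_eq_right (by linarith), mul_zero]

/-- `ψ₁` is continuous on `[0, x]` (hence on every `[1, x]`). -/
theorem continuousOn_psiOne (x : ℝ) : ContinuousOn psiOne (Set.Icc 0 x) := by
  have hc : ContinuousOn (fun t : ℝ ↦ ∑ n ∈ Finset.Ioc 0 ⌊x⌋₊,
      (ArithmeticFunction.vonMangoldt n : ℝ) * max (t - n) 0) (Set.Icc 0 x) := by
    refine continuous_finsetSum _ (fun n _ ↦ ?_) |>.continuousOn
    exact continuous_const.mul ((continuous_id.sub continuous_const).max continuous_const)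
  exact hc.congr fun t ht ↦ psiOne_eq_sum_posPart ht.1 ht.2

/-! ## The hinge integral -/

/-- For `1 ≤ n ≤ x`: `∫_1^x (t − n)⁺ t⁻³ dt = 1/(2n) − 1/x + n/(2x²)`. -/
theorem integral_posPart_div_cube {x : ℝ} {n : ℕ} (hn1 : 1 ≤ n) (hnx : (n : ℝ) ≤ x) :
    ∫ t in (1 : ℝ)..x, max (t - n) 0 / t ^ 3 = 1 / (2 * n) - 1 / x + n / (2 * x ^ 2) := by
  have hn1' : (1 : ℝ) ≤ n := by exact_mod_cast hn1
  have hn0 : (0 : ℝ) < n := by linarith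
  have hx0 : 0 < x := by linarith
  have hcont : Continuous fun t : ℝ ↦ max (t - n) 0 := (continuous_id.sub continuous_const).max continuous_const
  have hii : ∀ a b : ℝ, 0 < a → 0 < b → IntervalIntegrable (fun t : ℝ ↦ max (t - n) 0 / t ^ 3) volume a b := by
    intro a b ha hb
    refine (ContinuousOn.div hcont.continuousOn (by fun_prop) fun t ht ↦ ?_).intervalIntegrable
    have : 0 < t := by
      rw [Set.uIcc_eq_union] at ht
      rcases ht with h | h <;> linarith [h.1]
    positivity
  rw [← intervalIntegral.integral_add_adjacent_intervals (hii 1 n one_pos hn0) (hii n x hn0 hx0)]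
  -- on `[1, n]` the hinge vanishes
  have h1 : ∫ t in (1 : ℝ)..n, max (t - n) 0 / t ^ 3 = 0 := by
    rw [intervalIntegral.integral_congr (g := fun _ ↦ (0 : ℝ)) fun t ht ↦ ?_, intervalIntegral.integral_zero]
    rw [Set.uIcc_of_le hn1'] at ht
    show max (t - (n : ℝ)) 0 / t ^ 3 = 0
    rw [max_eq_right (by linarith [ht.2]), zero_div]
  -- on `[n, x]`: antiderivative `−1/t + n/(2t²)`
  have h2 : ∫ t in (n : ℝ)..x, max (t - n) 0 / t ^ 3 = 1 / (2 * n) - 1 / x + n / (2 * x ^ 2) := by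
    have hderiv : ∀ t ∈ Set.uIcc (n : ℝ) x,
        HasDerivAt (fun u : ℝ ↦ -u⁻¹ + n / 2 * (u ^ 2)⁻¹) (max (t - n) 0 / t ^ 3) t := by
      intro t ht
      rw [Set.uIcc_of_le hnx] at ht
      have ht0 : t ≠ 0 := by linarith [ht.1]
      have hmax : max (t - (n : ℝ)) 0 = t - n := max_eq_left (by linarith [ht.1])
      have h1 : HasDerivAt (fun u : ℝ ↦ u⁻¹) (-(t ^ 2)⁻¹) t := hasDerivAt_inv ht0
      have h2 := (hasDerivAt_pow 2 t).fun_inv (pow_ne_zero 2 ht0)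
      have h := h1.fun_neg.add (h2.const_mul ((n : ℝ) / 2))
      refine h.congr_deriv ?_
      rw [hmax]
      simp only [Nat.cast_ofNat]
      field_simp
      ring
    rw [intervalIntegral.integral_eq_sub_of_hasDerivAt hderiv (hii n x hn0 hx0)]
    field_simp
    ring
  rw [h1, h2, zero_add]

/-! ## The prime bracket -/

/-- **THE PRIME BRACKET (RH-FREE):** for `x ≥ 1`,
`ψ₁(x)/x + 2x ∫_1^x ψ₁(t) t⁻³ dt = Σ_{n ∈ (0,⌊x⌋]} Λ(n)(x/n − 1)` (`= x Σ_{n≤x} Λ(n)/n − ψ(x)`). -/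
theorem psiBracket_eq {x : ℝ} (hx : 1 ≤ x) :
    psiOne x / x + 2 * x * ∫ t in (1 : ℝ)..x, psiOne t / t ^ 3 =
      ∑ n ∈ Finset.Ioc 0 ⌊x⌋₊, (ArithmeticFunction.vonMangoldt n : ℝ) * (x / n - 1) := by
  have hx0 : 0 < x := by linarith
  -- the integral as a finite sum
  have hint : ∫ t in (1 : ℝ)..x, psiOne t / t ^ 3 =
      ∑ n ∈ Finset.Ioc 0 ⌊x⌋₊, (ArithmeticFunction.vonMangoldt n : ℝ) * ∫ t in (1 : ℝ)..x, max (t - n) 0 / t ^ 3 := by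
    have hcongr : ∫ t in (1 : ℝ)..x, psiOne t / t ^ 3 =
        ∫ t in (1 : ℝ)..x, ∑ n ∈ Finset.Ioc 0 ⌊x⌋₊,
          (ArithmeticFunction.vonMangoldt n : ℝ) * (max (t - n) 0 / t ^ 3) := by
      refine intervalIntegral.integral_congr fun t ht ↦ ?_
      rw [Set.uIcc_of_le hx] at ht
      show psiOne t / t ^ 3 = _
      rw [psiOne_eq_sum_posPart (by linarith [ht.1]) ht.2, Finset.sum_div]
      exact Finset.sum_congr rfl fun n _ ↦ by ring
    rw [hcongr, intervalIntegral.integral_finsetSum]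
    · exact Finset.sum_congr rfl fun n _ ↦ intervalIntegral.integral_const_mul _ _
    · intro n _
      refine ContinuousOn.intervalIntegrable ?_
      refine continuousOn_const.mul (ContinuousOn.div ?_ (by fun_prop) fun t ht ↦ ?_)
      · exact ((continuous_id.sub continuous_const).max continuous_const).continuousOn
      · rw [Set.uIcc_of_le hx] at ht
        have : 0 < t := by linarith [ht.1]
        positivity
  rw [hint, psiOne, Finset.sum_div, Finset.mul_sum, ← Finset.sum_add_distrib]
  refine Finset.sum_congr rfl fun n hn ↦ ?_
  rw [Finset.mem_Ioc] at hn
  have hn1 : 1 ≤ n := hn.1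
  have hnx : (n : ℝ) ≤ x := (Nat.cast_le.2 hn.2).trans (Nat.floor_le hx0.le)
  have hn0 : (0 : ℝ) < n := by exact_mod_cast hn.1
  rw [integral_posPart_div_cube hn1 hnx]
  field_simp
  ring

/-! ## Three elementary integrals on `[1, x]` -/

/-- `∫_1^x dt/(2t) = (log x)/2` (`x > 0`). -/
theorem integral_half_inv {x : ℝ} (hx : 0 < x) : ∫ t in (1 : ℝ)..x, 1 / (2 * t) = Real.log x / 2 := by
  have h : ∫ t in (1 : ℝ)..x, 1 / (2 * t) = ∫ t in (1 : ℝ)..x, 1 / 2 * t⁻¹ :=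
    intervalIntegral.integral_congr fun t _ ↦ by ring
  rw [h, intervalIntegral.integral_const_mul, integral_inv_of_pos one_pos hx, div_one]
  ring

/-- `∫_1^x t⁻² dt = 1 − 1/x` (`x > 0`). -/
theorem integral_inv_sq {x : ℝ} (hx : 0 < x) : ∫ t in (1 : ℝ)..x, (t ^ 2)⁻¹ = 1 - 1 / x := by
  have hderiv : ∀ t ∈ Set.uIcc (1 : ℝ) x, HasDerivAt (fun u : ℝ ↦ -u⁻¹) ((t ^ 2)⁻¹) t := by
    intro t ht
    have ht0 : t ≠ 0 := by
      rw [Set.uIcc_eq_union] at ht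
      rcases ht with h | h <;> linarith [h.1]
    have h := (hasDerivAt_inv ht0).fun_neg
    refine h.congr_deriv ?_
    ring
  have hint : IntervalIntegrable (fun t : ℝ ↦ (t ^ 2)⁻¹) volume 1 x := by
    refine (ContinuousOn.inv₀ (by fun_prop) fun t ht ↦ ?_).intervalIntegrable
    have : t ≠ 0 := by
      rw [Set.uIcc_eq_union] at ht
      rcases ht with h | h <;> linarith [h.1]
    positivity
  rw [intervalIntegral.integral_eq_sub_of_hasDerivAt hderiv hint]
  simp only [inv_one, one_div]
  ring

/-- `∫_1^x t⁻³ dt = (1 − 1/x²)/2` (`x > 0`). -/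
theorem integral_inv_cube {x : ℝ} (hx : 0 < x) : ∫ t in (1 : ℝ)..x, (t ^ 3)⁻¹ = (1 - 1 / x ^ 2) / 2 := by
  have hderiv : ∀ t ∈ Set.uIcc (1 : ℝ) x, HasDerivAt (fun u : ℝ ↦ -(1 / 2) * (u ^ 2)⁻¹) ((t ^ 3)⁻¹) t := by
    intro t ht
    have ht0 : t ≠ 0 := by
      rw [Set.uIcc_eq_union] at ht
      rcases ht with h | h <;> linarith [h.1]
    have h2 := (hasDerivAt_pow 2 t).fun_inv (pow_ne_zero 2 ht0)
    refine (h2.const_mul (-(1 / 2))).congr_deriv ?_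
    simp only [Nat.cast_ofNat]
    field_simp
    ring
  have hint : IntervalIntegrable (fun t : ℝ ↦ (t ^ 3)⁻¹) volume 1 x := by
    refine (ContinuousOn.inv₀ (by fun_prop) fun t ht ↦ ?_).intervalIntegrable
    have : t ≠ 0 := by
      rw [Set.uIcc_eq_union] at ht
      rcases ht with h | h <;> linarith [h.1]
    positivity
  rw [intervalIntegral.integral_eq_sub_of_hasDerivAt hderiv hint]
  field_simp
  ring

end DilateExplicit

end Summit.RiemannHypothesis.RiemannHypothesis.Theorems.NbTheory

end
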